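import Literature.Analysis.FluidPDE.ElgindiTransportL2Coercivity
import HarnessLib

/-!
# The radial `L^∞` embedding of the weighted space ([ElgindiGhoulMasmoudi2021] Lemma 9.1)

Topic `Literature/Analysis/FluidPDE`. Proof file (everything proved, no definitions, no named
facts) on the proof path of the named fact
`Literature.Analysis.FluidPDE.Elgindi.ElgindiGhoulMasmoudi2021_stabilityCore`
(`ElgindiStabilityDecomposition.lean`). T. M. Elgindi, T.-E. Ghoul, N. Masmoudi, *On the stability of
self-similar blow-up for `C^{1,α}` solutions to the incompressible Euler equations on `ℝ³`*,
Camb. J. Math. 9 (2021) = arXiv:1910.14071, §9 "Appendix: Product Rules", Lemma 9.1 (p. 20 of the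
held text), second display:

> "And for all `θ` we have `sup_z|g(z,θ)|² ≤ C∫₀^∞|D_zg(z,θ)|²(1+z)⁴/z⁴ dz`."

This is the one-dimensional inequality behind the embedding `𝓗ᵏ ↪ L^∞` used in all the product
and transport estimates of [EGM] §9 (Propositions 9.2–9.5). We prove it with the explicit constant
`C = 1/3 = ∫₀^∞ s²/(1+s)⁴ds` for `C¹` functions compactly supported in `(0, ∞)` (the test-function
class of the coercivity files): `g(z) = ∫₀ᶻ g' = ∫₀ᶻ (sg'·w)(s/(1+s)²)ds`, `w = (1+s)²/s²`, and
Cauchy–Schwarz (`sq_le_integral_sq_Dz₁`).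
-/

noncomputable section

open MeasureTheory Set Real Filter intervalIntegral
open _root_.Topology

namespace Literature.Analysis.FluidPDE

namespace Elgindi

/-! ### A radial constant -/

/-- `∫₀^∞ s²/(1+s)⁴ ds = 1/3` (antiderivative `−(3s²+3s+1)/(3(1+s)³) = −(1+s)⁻¹ + (1+s)⁻² − ⅓(1+s)⁻³`). [folklore] -/
theorem integral_Ioi_sq_div_one_add_pow_four : ∫ z in Ioi (0 : ℝ), z ^ 2 / (1 + z) ^ 4 = 1 / 3 := by
  have hd : ∀ z ∈ Ici (0 : ℝ), HasDerivAt (fun z : ℝ => -((1 + z) ^ 1)⁻¹ + ((1 + z) ^ 2)⁻¹ -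
      (1 / 3) * ((1 + z) ^ 3)⁻¹) (z ^ 2 / (1 + z) ^ 4) z := by
    intro z hz
    have hz1 : (1 + z) ≠ 0 := by have : (0 : ℝ) ≤ z := hz; positivity
    have h1 : HasDerivAt (fun z : ℝ => 1 + z) 1 z := by simpa using (hasDerivAt_id' z).const_add 1
    have hp : ∀ n : ℕ, HasDerivAt (fun z : ℝ => ((1 + z) ^ n)⁻¹)
        (-(↑n * (1 + z) ^ (n - 1) * 1) / ((1 + z) ^ n) ^ 2) z := fun n =>
      (h1.fun_pow n).fun_inv (pow_ne_zero n hz1)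
    have h := (((hp 1).neg).add (hp 2)).sub ((hp 3).const_mul (1 / 3))
    refine h.congr_deriv ?_
    push_cast
    field_simp
    ring
  have ht : Tendsto (fun z : ℝ => 1 + z) atTop atTop := tendsto_atTop_add_const_left _ 1 tendsto_id
  have hl : ∀ n : ℕ, n ≠ 0 → Tendsto (fun z : ℝ => ((1 + z) ^ n)⁻¹) atTop (𝓝 0) := fun n hn =>
    tendsto_inv_atTop_zero.comp ((tendsto_pow_atTop hn).comp ht)
  have hlim : Tendsto (fun z : ℝ => -((1 + z) ^ 1)⁻¹ + ((1 + z) ^ 2)⁻¹ -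
      (1 / 3) * ((1 + z) ^ 3)⁻¹) atTop (𝓝 0) := by
    have h := (((hl 1 (by norm_num)).neg).add (hl 2 (by norm_num))).sub ((hl 3 (by norm_num)).const_mul (1 / 3))
    convert h using 2
    norm_num
  rw [integral_Ioi_of_hasDerivAt_of_nonneg' hd (fun z hz => by
    have : (0 : ℝ) < z := hz; positivity) hlim]
  norm_num

/-! ### Functions supported away from the origin -/

/-- A compactly supported function with support inside `(0, ∞)` vanishes, together with its
derivative, below some `a > 0`. [folklore] -/
theorem exists_pos_forall_lt_eq_zero {g : ℝ → ℝ} (hs : HasCompactSupport g) (hsub : tsupport g ⊆ Ioi 0) :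
    ∃ a : ℝ, 0 < a ∧ (∀ s, s < a → g s = 0) ∧ ∀ s, s < a → deriv g s = 0 := by
  rcases (tsupport g).eq_empty_or_nonempty with he | hne
  · have hg : ∀ s, g s = 0 := fun s => image_eq_zero_of_notMem_tsupport (by rw [he]; simp)
    refine ⟨1, one_pos, fun s _ => hg s, fun s _ => ?_⟩
    have : g = fun _ => 0 := funext hg
    rw [this, deriv_const]
  · obtain ⟨m, hm, hmin⟩ := hs.isCompact.exists_isMinOn hne continuous_id.continuousOn
    have hm0 : 0 < m := hsub hm
    have hzero : ∀ s, s < m → g s = 0 := fun s hs' =>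
      image_eq_zero_of_notMem_tsupport fun h => absurd (hmin h) (by simpa using hs')
    refine ⟨m, hm0, hzero, fun s hs' => ?_⟩
    have : g =ᶠ[𝓝 s] fun _ => 0 :=
      Filter.eventuallyEq_of_mem (Iio_mem_nhds hs') fun y hy => hzero y hy
    rw [this.deriv_eq, deriv_const]

/-! ### Lemma 9.1, radial part -/

/-- **The radial `L^∞` embedding** (EGM Lemma 9.1, second inequality, with `C = 1/3`): for
`g ∈ C¹(ℝ)` compactly supported inside `(0, ∞)` and every `z`,
`g(z)² ≤ ⅓∫₀^∞ (D_z g)²·((1+s)²/s²)² ds`. [cite: ElgindiGhoulMasmoudi2021, §9 Lemma 9.1 (p. 20 of arXiv:1910.14071)] -/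
theorem sq_le_integral_sq_Dz₁ {g : ℝ → ℝ} (hg : ContDiff ℝ 1 g) (hs : HasCompactSupport g)
    (hsub : tsupport g ⊆ Ioi 0) (z : ℝ) :
    g z ^ 2 ≤ (1 / 3) * ∫ s in Ioi (0 : ℝ), (Dz₁ g s * radialWeight s) ^ 2 := by
  have hgc : Continuous g := hg.continuous
  have hdc : Continuous (deriv g) := hg.continuous_deriv le_rfl
  have hd : Differentiable ℝ g := hg.differentiable (by simp)
  obtain ⟨a, ha, hga, hda⟩ := exists_pos_forall_lt_eq_zero hs hsub
  -- the weighted derivative `Φ = D_z g · w = g'(1+s)²/s`, continuous on `ℝ` (it vanishes below `a`)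
  set Φ : ℝ → ℝ := fun s => Dz₁ g s * radialWeight s with hΦ
  have hΦeq : ∀ s, s ≠ 0 → Φ s = ((1 + s) ^ 2 / s) * deriv g s := by
    intro s hs0
    simp only [hΦ, Dz₁_apply, radialWeight]
    field_simp
  have hΦc : Continuous Φ := by
    have h := continuous_mul_of_eq_zero_lt (u := fun s => (1 + s) ^ 2 / s) (M := deriv g)
      (ContinuousOn.div (by fun_prop) continuousOn_id fun s hs => hs) hdc ha hda
    refine (continuous_congr fun s => ?_).2 h
    by_cases hs0 : s = 0
    · subst hs0
      simp [hΦ, Dz₁_apply, hda 0 ha]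
    · exact hΦeq s hs0
  have hΦs : HasCompactSupport Φ := by
    refine HasCompactSupport.mul_right ?_
    refine HasCompactSupport.mul_left ?_
    exact hs.deriv
  -- the global integral is finite and nonnegative
  have hΦs2 : HasCompactSupport (fun s => Φ s ^ 2) := hΦs.comp_left (g := fun x : ℝ => x ^ 2) (by norm_num)
  have hI : Integrable (fun s => Φ s ^ 2) (volume.restrict (Ioi 0)) :=
    ((hΦc.pow 2).integrable_of_hasCompactSupport hΦs2).integrableOn
  have hInn : 0 ≤ ∫ s in Ioi (0 : ℝ), Φ s ^ 2 := integral_nonneg fun s => sq_nonneg _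
  rcases le_or_gt z 0 with hz | hz
  · -- outside the support
    have : g z = 0 := image_eq_zero_of_notMem_tsupport fun h => absurd (hsub h) (not_lt.2 hz)
    rw [this]
    simpa using hInn
  -- `g z = ∫₀ᶻ g' = ∫_{(0,z]} Φ ψ`, `ψ = s/(1+s)²`
  set ψ : ℝ → ℝ := fun s => s / (1 + s) ^ 2 with hψ
  have hψc : ContinuousOn ψ (Ici 0) := by
    simp only [hψ]
    exact ContinuousOn.div continuousOn_id (by fun_prop) fun s hs => by
      have : (0 : ℝ) ≤ s := hs; positivity
  have hg0 : g 0 = 0 := hga 0 ha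
  have hFTC : g z = ∫ s in (0 : ℝ)..z, deriv g s := by
    rw [intervalIntegral.integral_deriv_eq_sub (fun s _ => hd s) (hdc.intervalIntegrable _ _), hg0, sub_zero]
  have hrepr : ∫ s in (0 : ℝ)..z, deriv g s = ∫ s in Ioc 0 z, Φ s * ψ s := by
    rw [intervalIntegral.integral_of_le hz.le]
    refine setIntegral_congr_fun measurableSet_Ioc fun s hs => ?_
    have hs0 : s ≠ 0 := hs.1.ne'
    rw [hΦeq s hs0]
    simp only [hψ]
    have : (1 + s) ≠ 0 := by have := hs.1; positivity
    field_simp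
  -- Cauchy–Schwarz on `(0, z]`
  haveI : IsFiniteMeasure (volume.restrict (Ioc (0 : ℝ) z)) := isFiniteMeasure_restrict.2 measure_Ioc_lt_top.ne
  have hψb : ∀ s ∈ Ioc (0 : ℝ) z, |ψ s| ≤ 1 := by
    intro s hs
    simp only [hψ]
    have hs0 : 0 < s := hs.1
    rw [abs_of_nonneg (by positivity), div_le_one (by positivity)]
    nlinarith
  have iΦ2 : Integrable (fun s => Φ s ^ 2) (volume.restrict (Ioc 0 z)) := hI.mono_measure
    (Measure.restrict_mono Ioc_subset_Ioi_self le_rfl)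
  have hψm : AEStronglyMeasurable ψ (volume.restrict (Ioc (0 : ℝ) z)) :=
    (hψc.mono fun s hs => (hs.1).le).aestronglyMeasurable measurableSet_Ioc
  have iψ2 : Integrable (fun s => ψ s ^ 2) (volume.restrict (Ioc 0 z)) := by
    refine Integrable.mono' (integrable_const 1) (hψm.pow 2) ?_
    rw [ae_restrict_iff' measurableSet_Ioc]
    refine Filter.Eventually.of_forall fun s hs => ?_
    rw [Real.norm_eq_abs, abs_pow]
    have := hψb s hs
    nlinarith [abs_nonneg (ψ s)]
  have iΦψ : Integrable (fun s => Φ s * ψ s) (volume.restrict (Ioc 0 z)) := by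
    refine Integrable.mono' ((hΦc.integrable_of_hasCompactSupport hΦs).integrableOn.norm)
      (hΦc.aestronglyMeasurable.mul hψm) ?_
    rw [ae_restrict_iff' measurableSet_Ioc]
    refine Filter.Eventually.of_forall fun s hs => ?_
    rw [Real.norm_eq_abs, Real.norm_eq_abs, abs_mul]
    have := hψb s hs
    nlinarith [abs_nonneg (Φ s), abs_nonneg (ψ s)]
  have hCS := sq_integral_mul_le iΦ2 iψ2 iΦψ
  -- the two factors
  have hA : ∫ s in Ioc 0 z, Φ s ^ 2 ≤ ∫ s in Ioi (0 : ℝ), Φ s ^ 2 :=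
    setIntegral_mono_set hI (ae_of_all _ fun s => sq_nonneg _) (ae_of_all _ Ioc_subset_Ioi_self)
  have hB : ∫ s in Ioc 0 z, ψ s ^ 2 ≤ 1 / 3 := by
    have hJ : IntegrableOn (fun s : ℝ => s ^ 2 / (1 + s) ^ 4) (Ioi 0) := by
      by_contra h
      have := integral_Ioi_sq_div_one_add_pow_four
      rw [integral_undef h] at this
      norm_num at this
    have e : ∫ s in Ioc 0 z, ψ s ^ 2 = ∫ s in Ioc 0 z, s ^ 2 / (1 + s) ^ 4 := by
      refine setIntegral_congr_fun measurableSet_Ioc fun s hs => ?_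
      simp only [hψ]
      rw [div_pow, ← pow_mul]
    rw [e, ← integral_Ioi_sq_div_one_add_pow_four]
    exact setIntegral_mono_set hJ (ae_of_all _ fun s => by positivity)
      (ae_of_all _ Ioc_subset_Ioi_self)
  have hψnn : 0 ≤ ∫ s in Ioc 0 z, ψ s ^ 2 := integral_nonneg fun s => sq_nonneg _
  have hΦnn : 0 ≤ ∫ s in Ioc 0 z, Φ s ^ 2 := integral_nonneg fun s => sq_nonneg _
  rw [hFTC, hrepr]
  calc (∫ s in Ioc 0 z, Φ s * ψ s) ^ 2 ≤ (∫ s in Ioc 0 z, Φ s ^ 2) * ∫ s in Ioc 0 z, ψ s ^ 2 := hCS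
    _ ≤ (∫ s in Ioi (0 : ℝ), Φ s ^ 2) * (1 / 3) := mul_le_mul hA hB hψnn hInn
    _ = (1 / 3) * ∫ s in Ioi (0 : ℝ), (Dz₁ g s * radialWeight s) ^ 2 := by rw [mul_comm]

end Elgindi

end Literature.Analysis.FluidPDE
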